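import Literature.AlgebraicGeometry.Hyperkaehler.GeneralizedKummerTypeHodgeConjecture
import Literature.AlgebraicGeometry.HodgeTheory.MotivatedClasses
import Literature.AlgebraicGeometry.HodgeTheory.ChernCharacterBetti
import Literature.AlgebraicGeometry.Motives.MotivatedPeriodTorsor
import HarnessLib

/-!
# Rational Hodge similitudes between varieties of generalized Kummer type are algebraic (Varesco 2023 / Floccari–Varesco 2024 §§3–4) — DEFINITIONS + NAMED FACTS

Layer `Literature/AlgebraicGeometry/Hyperkaehler`.  Typed for the cross-ladder literature-typing layer
(D-0088(4), tranche LT-H4 "open-question harvest", seat `hodge-lit-oqh-2`; consumers: the `oqh` /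
`transfer` lens seats on `HodgeConjecture` and the ladder rungs H2/H3 of LADDER-HodgeAV): the PROVED
results of Floccari–Varesco 2024 §3–§4 that the tree did not yet hold — the mechanism by which varieties
of `Kumⁿ`-type of DIFFERENT dimensions are related through algebraic correspondences in degree `2`
("transfer" between `Kumⁿ` and `Kum³`, and thence to the K3 surface `S_K` of Floccari 2024).  The tree
already holds, BY NAME: `FloccariVaresco2024_degreeTwoGenerated_hodgeClasses_algebraic` (Thm. 1.1),
`FloccariVaresco2024_hodgeClasses_algebraic_kum2Type` (Cor. 1.2), `Floccari2023_hodgeClasses_algebraic_kum3Type`,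
`degreeTwoGenerated` (file `GeneralizedKummerTypeHodgeConjecture`), `IsOfGeneralizedKummerType` (file
`GeneralizedKummerType`), `Markman2024_rationalHodgeIsometry_algebraic` (the `K3^[n]` analogue, file
`MarkmanRationalHodgeIsometries`), and the typed OPEN target `Summit.HodgeConjecture.CorCM.Stage4.HC_KummerType`
(all `n ≥ 2`; a THEOREM in print for `n = 2, 3`).  Nothing in this file asserts a case of the Hodge
conjecture; the three records below are THEOREMS IN PRINT (REFEREED), unproved in the tree.

## Sources (read at source; locators = files of the materialised arXiv texts)

* [FV24] S. Floccari, M. Varesco, *Algebraic cycles on hyper-Kähler varieties of generalized Kummer type*,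
  Math. Ann. 391 (2025) (arXiv:2308.04865) [`FloccariVaresco2024`; REFEREED].
  §3 [corpus:paper-arxiv-2308.04865 p0006:L19–L28], verbatim: "Let `r ≠ 0` be a rational number. A
  similitude of multiplier `r` between two quadratic spaces `V₁` and `V₂` is a linear isomorphism
  `t : V₁ → V₂` which multiplies the form by a factor `r`, i. e., such that `(t(u),t(w))₂ = r · (u,w)₁` for
  all `u,w ∈ V₁`.  **Theorem 3.3** ([Varesco]). Let `X₁, X₂` be varieties of generalized Kummer type (not
  necessarily of the same dimension). Assume that `φ : H²(X₁,ℚ) ⥲ H²(X₂,ℚ)` is a rational Hodge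
  similitude. Then `φ` is induced by an algebraic cycle on `X₁ × X₂`."  (L30: "The main observation
  behind this result is that the similitude `φ` induces an isogeny between the Kuga-Satake varieties of
  `X₁` and `X₂`. The above statement is then deduced using the algebraicity of the Kuga-Satake
  correspondence and Foster's Theorem 3.1.")  §1 [p0003:L5]: "`X` is a hyper-Kähler variety of generalized
  Kummer type […] if it is a projective deformation of [the] generalized Kummer variety"; §3 [p0006:L3]:
  "Let `X` be a `Kumⁿ`-variety, `n ≥ 2`."
  §4 **Lemma 4.3** [p0007:L33–L40], verbatim: "For any projective variety `X` of `Kumⁿ`-type, there exists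
  a projective variety `K` of `Kum³`-type and a Hodge similitude of multiplier `n+1`
  `φ : H²(K,ℚ) ⥲ H²(X,ℚ)` with respect to the Beauville-Bogomolov pairings." (Proof, L42–L63: an explicit
  rational similitude `Λ_{Kum³} ⊗ ℚ ⥲ Λ_{Kumⁿ} ⊗ ℚ` of multiplier `n+1`, surjectivity of the period map
  [Huy99], Huybrechts' projectivity criterion.)  Proof of Thm. 1.1 [p0007:L67–L69]: "Given the projective
  `Kumⁿ`-variety `X`, we consider the `Kum³`-variety `K` given by Lemma 4.3. The same lemma gives a Hodge
  similitude `φ : H²(K,ℚ) ⥲ H²(X,ℚ)`, which is induced by an algebraic cycle on `K × X` by Theorem 3.3."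
  §4 **Remark 4.4** [p0008:L16–L18], verbatim: "Let `X` be a `Kumⁿ`-variety as above and consider any power
  `Z = Xʳ`. Denote by `A₂•(Z)` the subalgebra of `H•(Z,ℚ)` generated by `H²(Z,ℚ)`. Then our argument
  implies that all Hodge classes in `A₂•(Z)` are algebraic."
* [Var23] M. Varesco, *Hodge similarities, algebraic classes, and Kuga–Satake varieties*, Math. Z. 305
  (2023), no. 69 (arXiv:2304.02519) [`Varesco2023`; REFEREED] — the proof cited by [FV24]: Def. 1.2
  [corpus:paper-arxiv-2304.02519 p0007:L45–L52] ("Hodge similarity … multiplier"), Thm. 4.5 / Cor. 4.6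
  [p0016:L1–L8, L67–L69] ("Let `X` and `X'` be hyperkähler manifolds satisfying the Kuga–Satake Hodge
  conjecture. Assume moreover that `X` satisfies the Lefschetz standard conjecture in degree two. Then,
  every Hodge similarity `ψ : T(X') → T(X)` is algebraic."), **Theorem 5.1** [p0017:L10–L12] ("Let `X` and
  `X'` be hyperkähler manifolds of generalized Kummer type such that `T(X)` and `T(X')` are Hodge
  similar. Then, every Hodge morphism between `T(X')` and `T(X)` is algebraic."), Remark 5.2 [p0017:L17]
  ("also covers the case where `X` and `X'` are […] of different dimension").
* [Flo24] S. Floccari, *Sixfolds of generalized Kummer type and K3 surfaces*, Compos. Math. 160 (2024)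
  388–410 (arXiv:2210.02948) [`Floccari2024`; REFEREED], **Theorem 1.4** [corpus:paper-arxiv-2210.02948
  p0004:L6–L7, headed "Theorem 4." in the arXiv text; pointer corrected 2026-08-26 after the vhodge-lit g15
  locator audit]: "Let `K, K'` be projective varieties of deformation type `Kum³`. Let
  `f : H²(K, ℚ) ⥲ H²(K', ℚ)` be a Hodge isometry. Then `f` is induced by an algebraic correspondence."
  (the case `n₁ = n₂ = 3`, multiplier `1`, of [FV24] Thm. 3.3).
* A. Beauville, J. Differential Geom. 18 (1983), §8 Thm. 5; D. Huybrechts, Invent. Math. 135 (1999)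
  §1.9–1.11 (the Beauville–Bogomolov form `q_X` and Fujiki's relation `∫_X α^{2n} = c_X · q_X(α)ⁿ`,
  `c_X > 0` a deformation invariant) — used only to JUSTIFY the rendering of "the Beauville–Bogomolov
  pairing" below; keys `Beauville1983`, `Huybrechts1999`.

## Rendering (tree carriers) and faithfulness

* "`Kumⁿ`-variety" (projective, `n ≥ 2`): `Motives.IsSmoothProjective (2 * n) X ∧ IsOfGeneralizedKummerType n X`,
  exactly as in every `Kumⁿ` record of this layer.
* "the Beauville–Bogomolov pairing on `H²(X, ℚ)`" — the tree has no rational BBF form on the real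
  carriers (`beauvilleForm` of file `BeauvilleBogomolovForm` is Beauville's `q_σ`, relative to an
  orientation and a normalised `(2,0)`-class).  This file pins the form ORIENTATION-FREE and
  MARKING-FREE through FUJIKI'S RELATION: `IsFujikiForm n X b` says that the symmetric `ℂ`-bilinear form
  `b` on `H²(X(ℂ); ℂ)` satisfies `a^{2n} = (c · b(a,a)ⁿ) · P` for all `a`, for some constant `c ≠ 0` and
  some generator `P ≠ 0` of `H^{4n}(X(ℂ); ℂ)` (`HodgeTheory.cupPowTwo a (2 * n)`).  Classically, for `X`
  compact hyperkähler of dimension `2n` with `b₂ ≥ 4`, these are EXACTLY the non-zero complex multiples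
  `λ · (q_X ⊗ ℂ)`, `λ ∈ ℂˣ`: Fujiki's relation shows `q_X ⊗ ℂ` is one (non-vacuity), and conversely
  `bⁿ = λ' · q_Xⁿ` as polynomial functions on `H²` forces `b ∈ ℂˣ · q_X` (`ℂ[H²]` is factorial and the
  non-degenerate quadratic form `q_X` of rank `b₂ ≥ 3` is irreducible).  The SCALE of `b` is therefore
  free — and with it the numerical value of a multiplier: the records below keep "Hodge similitude" but
  DO NOT RECORD the printed multipliers (`n+1` in Lemma 4.3; `1` in [Flo24] Thm. 1.4).  WEAKER THAN
  PRINT in exactly this respect, nowhere stronger.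
* "rational Hodge similitude `φ : H²(X₁,ℚ) ⥲ H²(X₂,ℚ)`": `IsRationalHodgeSimilitude n₁ n₂ X₁ X₂ f` for a
  `ℂ`-linear `f : H²(X₁(ℂ); ℂ) → H²(X₂(ℂ); ℂ)` — bijective, mapping rational classes to rational classes
  (`HodgeTheory.IsRationalClass`; with bijectivity and `b₂(X₁) = b₂(X₂)` — automatic here, `b₂ = 7` —
  `f` is the complexification of a `ℚ`-isomorphism), mapping classes of Hodge type `(i,j)` to classes of
  type `(i,j)` (`HodgeTheory.IsOfHodgeType`, the routes' `∃`-over-Hodge-models predicate; same clause as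
  `Markman2024_rationalHodgeIsometry_algebraic`), and ISOMETRIC for SOME pair of Fujiki forms `b₁`, `b₂`
  (`b₂(f x, f y) = b₁(x, y)`; since `bᵢ = λᵢ q_{Xᵢ}`, this says `q_{X₂}(f x, f y) = (λ₁/λ₂) q_{X₁}(x,y)`,
  and the complex multiplier `λ₁/λ₂` is automatically RATIONAL: `q_{X₁}` takes a non-zero rational value
  on some rational class, and `q_{X₂}` is `ℚ`-valued on the rational class `f x`).  So the clause is
  equivalent to the printed "rational Hodge similitude with respect to the Beauville–Bogomolov
  pairings", multiplier unrecorded.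
* "induced by an algebraic cycle on `X₁ × X₂`": the tree's `HodgeTheory.IsAlgebraicCorrespondence
  (2 * n₂) (2 * n₁) X₂ X₁ f` (file `HodgeTheory/MotivatedClasses`: `f = γ^* = pr_{X₂*}(pr_{X₁}^* (·) ∪ γ)`
  for a class `γ` in the `ℂ`-span of cycle classes on `X₂ × X₁`, target listed first; orientation-free).
  A rational cycle is in particular such a `γ`: nothing beyond print.
* "any power `Z = Xʳ`", "`A₂•(Z)`": the cartesian power `X.pow r` (`Motives.SchemeOver.pow`, dimension
  `r * (2 * n)`, `Motives.IsSmoothProjective.pow`) and `degreeTwoGenerated (X.pow r) j = A₂^{2j}(Xʳ) ⊗ ℂ`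
  (file `GeneralizedKummerTypeHodgeConjecture`; for a rational class, membership is membership in
  `A₂^{2j}(Xʳ)`), conclusion `algebraicClasses (X.pow r) j` — symbol for symbol the rendering of Thm. 1.1
  in that file, on `Xʳ`.  (`r = 0`: `X⁰ = Spec ℂ`, harmless; `r = 1`: `X¹ = Spec ℂ × X ≅ X`.)

## Content and D-0026 accounting

Definitions (real, with API): `IsFujikiForm`, `IsRationalHodgeSimilitude`.  Named facts (+3, each a
refereed published theorem cited at the line; none restates a tree fact — `lean search` for
`similitude|Similar|Varesco|Remark 4.4|pow` in `Hyperkaehler/`, `HodgeTheory/`, `Summits/HodgeConjecture`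
found only the `K3^[n]` isometry record and the `r = 1` Thm. 1.1 record):
`Varesco2023_hodgeSimilitude_algebraic_kummerType` ([FV24] Thm. 3.3 = [Var23] Thm. 5.1/Cor. 4.6),
`FloccariVaresco2024_exists_kum3_hodgeSimilitude` ([FV24] Lemma 4.3),
`FloccariVaresco2024_degreeTwoGenerated_hodgeClasses_algebraic_powers` ([FV24] Rem. 4.4).  Kernel
consequences: [Flo24] Thm. 1.4 by name (`.floccari2024_kum3Type`); the first step of the proof of
[FV24] Thm. 1.1 (`FloccariVaresco2024_exists_kum3_hodgeSimilitude.exists_algebraicCorrespondence`: every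
projective `Kumⁿ`-variety receives an algebraic correspondence from a projective `Kum³`-variety inducing
a rational Hodge similitude on `H²`); the `Kum⁴` spelling of Rem. 4.4 for the cell `hodge-kum4`.

## Not here

The K3 surface `S_K` and the `K3^[3]`-type resolution `Y_K → K/G` of [Flo24] Thms. 1.1–1.2 and their
extension to all `Kumⁿ` (Floccari, Geom. Topol. 30 (2026) Thms. 1.1–1.2) — these need moduli of sheaves
on K3 surfaces, absent from the tree; the multiplier values; [Var23] Thm. 4.5 in its general form (any
hyperkähler `X`, `X'` satisfying the Kuga–Satake Hodge conjecture) — the tree's Kuga–Satake predicates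
(`HodgeTheory.IsKSCorrespondenceAlgebraicBetti`) are for surfaces only; any proof.
-/

noncomputable section

open CategoryTheory MonoidalCategory

namespace Literature.AlgebraicGeometry.Hyperkaehler

open HodgeTheory

/-! ### The Beauville–Bogomolov form up to scalar, pinned by Fujiki's relation -/

/-- **A Fujiki form on `H²(X(ℂ); ℂ)`** (`X` intended compact hyperkähler of dimension `2n`): a symmetric
`ℂ`-bilinear form `b` satisfying FUJIKI'S RELATION `a^{2n} = (c · b(a,a)ⁿ) · P` for every
`a ∈ H²(X(ℂ); ℂ)`, for some constant `c ≠ 0` and some `P ≠ 0` in `H^{4n}(X(ℂ); ℂ)` (Huybrechts 1999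
§1.11: "`∫_X α^{2n} = c · q_X(α)ⁿ`", `c > 0`; Beauville 1983 Thm. 5).  Classically these are exactly
the non-zero complex multiples of the complexified Beauville–Bogomolov form `q_X` (module docstring:
unique factorisation in `ℂ[H²]`, `q_X` irreducible), so the predicate names "the BBF form up to scalar"
without orientations or markings.  Junk analysis: if `H^{4n}(X(ℂ); ℂ) = 0` (wrong `n`) no `P ≠ 0` exists
and the predicate is `False` (safe side). [cite: Huybrechts1999, §1.9 and §1.11 (Fujiki relation)]
[cite: Beauville1983, §8 Thm. 5] -/
def IsFujikiForm (n : ℕ) (X : Motives.SchemeOver ℂ)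
    (b : complexBetti X 2 →ₗ[ℂ] complexBetti X 2 →ₗ[ℂ] ℂ) : Prop :=
  (∀ x y, b x y = b y x) ∧
    ∃ (c : ℂ) (P : complexBetti X (2 * (2 * n))), c ≠ 0 ∧ P ≠ 0 ∧
      ∀ a : complexBetti X 2, cupPowTwo a (2 * n) = (c * b a a ^ n) • P

variable {n : ℕ} {X : Motives.SchemeOver ℂ}

/-- Unfolding lemma. [cite: Huybrechts1999, §1.11] -/
theorem isFujikiForm_iff {b : complexBetti X 2 →ₗ[ℂ] complexBetti X 2 →ₗ[ℂ] ℂ} :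
    IsFujikiForm n X b ↔ (∀ x y, b x y = b y x) ∧
      ∃ (c : ℂ) (P : complexBetti X (2 * (2 * n))), c ≠ 0 ∧ P ≠ 0 ∧
        ∀ a : complexBetti X 2, cupPowTwo a (2 * n) = (c * b a a ^ n) • P :=
  Iff.rfl

/-- A Fujiki form is symmetric. [cite: Huybrechts1999, §1.9] -/
theorem IsFujikiForm.symm {b : complexBetti X 2 →ₗ[ℂ] complexBetti X 2 →ₗ[ℂ] ℂ}
    (hb : IsFujikiForm n X b) (x y : complexBetti X 2) : b x y = b y x :=
  hb.1 x y

/-- **Scale invariance**: a non-zero complex multiple of a Fujiki form is a Fujiki form (the constant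
`c` becomes `c · t⁻ⁿ`) — the predicate pins the Beauville–Bogomolov form only up to `ℂˣ`.
[cite: Huybrechts1999, §1.11] -/
theorem IsFujikiForm.smul {b : complexBetti X 2 →ₗ[ℂ] complexBetti X 2 →ₗ[ℂ] ℂ}
    (hb : IsFujikiForm n X b) {t : ℂ} (ht : t ≠ 0) : IsFujikiForm n X (t • b) := by
  obtain ⟨hsymm, c, P, hc, hP, hrel⟩ := hb
  refine ⟨fun x y ↦ ?_, c * (t ^ n)⁻¹, P, mul_ne_zero hc (inv_ne_zero (pow_ne_zero n ht)), hP,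
    fun a ↦ ?_⟩
  · simp only [LinearMap.smul_apply, smul_eq_mul, hsymm x y]
  · rw [hrel a]
    congr 1
    simp only [LinearMap.smul_apply, smul_eq_mul, mul_pow]
    field_simp

/-! ### Rational Hodge similitudes of `H²` -/

/-- **`f : H²(X₁(ℂ); ℂ) → H²(X₂(ℂ); ℂ)` is (the complexification of) a rational Hodge similitude with
respect to the Beauville–Bogomolov pairings** ([FV24] §3: "a linear isomorphism `t : V₁ → V₂` which
multiplies the form by a factor `r`", "rational Hodge similitude"; [Var23] Def. 1.2 "Hodge
similarity"): `f` is bijective, maps rational classes to rational classes and classes of Hodge type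
`(i,j)` (for `dim X₁ = 2n₁`) to classes of type `(i,j)` (for `dim X₂ = 2n₂`), and is ISOMETRIC for some
pair of Fujiki forms `b₁` on `X₁`, `b₂` on `X₂` — i.e. (module docstring) `q_{X₂}(f x, f y) = r q_{X₁}(x, y)`
for a non-zero multiplier `r`, automatically rational, whose VALUE is not recorded.
[cite: FloccariVaresco2024, §3 (definition of similitude before Thm. 3.3)] [cite: Varesco2023, Def. 1.2] -/
def IsRationalHodgeSimilitude (n₁ n₂ : ℕ) (X₁ X₂ : Motives.SchemeOver ℂ)
    (f : complexBetti X₁ 2 →ₗ[ℂ] complexBetti X₂ 2) : Prop :=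
  Function.Bijective f ∧
    (∀ x, IsRationalClass x → IsRationalClass (f x)) ∧
    (∀ (i j : ℕ) (x : complexBetti X₁ 2),
        IsOfHodgeType (2 * n₁) X₁ 2 i j x → IsOfHodgeType (2 * n₂) X₂ 2 i j (f x)) ∧
    ∃ (b₁ : complexBetti X₁ 2 →ₗ[ℂ] complexBetti X₁ 2 →ₗ[ℂ] ℂ)
      (b₂ : complexBetti X₂ 2 →ₗ[ℂ] complexBetti X₂ 2 →ₗ[ℂ] ℂ),
      IsFujikiForm n₁ X₁ b₁ ∧ IsFujikiForm n₂ X₂ b₂ ∧ ∀ x y, b₂ (f x) (f y) = b₁ x y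

variable {n₁ n₂ : ℕ} {X₁ X₂ : Motives.SchemeOver ℂ} {f : complexBetti X₁ 2 →ₗ[ℂ] complexBetti X₂ 2}

/-- Unfolding lemma. [cite: FloccariVaresco2024, §3 (definition of similitude before Thm. 3.3)] -/
theorem isRationalHodgeSimilitude_iff : IsRationalHodgeSimilitude n₁ n₂ X₁ X₂ f ↔
    Function.Bijective f ∧
      (∀ x, IsRationalClass x → IsRationalClass (f x)) ∧
      (∀ (i j : ℕ) (x : complexBetti X₁ 2),
          IsOfHodgeType (2 * n₁) X₁ 2 i j x → IsOfHodgeType (2 * n₂) X₂ 2 i j (f x)) ∧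
      ∃ (b₁ : complexBetti X₁ 2 →ₗ[ℂ] complexBetti X₁ 2 →ₗ[ℂ] ℂ)
        (b₂ : complexBetti X₂ 2 →ₗ[ℂ] complexBetti X₂ 2 →ₗ[ℂ] ℂ),
        IsFujikiForm n₁ X₁ b₁ ∧ IsFujikiForm n₂ X₂ b₂ ∧ ∀ x y, b₂ (f x) (f y) = b₁ x y :=
  Iff.rfl

namespace IsRationalHodgeSimilitude

/-- A rational Hodge similitude is bijective. [cite: FloccariVaresco2024, §3] -/
theorem bijective (h : IsRationalHodgeSimilitude n₁ n₂ X₁ X₂ f) : Function.Bijective f :=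
  h.1

/-- A rational Hodge similitude maps rational classes to rational classes. [cite: FloccariVaresco2024, §3] -/
theorem isRationalClass_map (h : IsRationalHodgeSimilitude n₁ n₂ X₁ X₂ f) {x : complexBetti X₁ 2}
    (hx : IsRationalClass x) : IsRationalClass (f x) :=
  h.2.1 x hx

/-- A rational Hodge similitude preserves Hodge types. [cite: FloccariVaresco2024, §3] -/
theorem isOfHodgeType_map (h : IsRationalHodgeSimilitude n₁ n₂ X₁ X₂ f) {i j : ℕ}
    {x : complexBetti X₁ 2} (hx : IsOfHodgeType (2 * n₁) X₁ 2 i j x) :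
    IsOfHodgeType (2 * n₂) X₂ 2 i j (f x) :=
  h.2.2.1 i j x hx

/-- A rational Hodge similitude is isometric for some pair of Fujiki forms. [cite: FloccariVaresco2024, §3] -/
theorem exists_isFujikiForm (h : IsRationalHodgeSimilitude n₁ n₂ X₁ X₂ f) :
    ∃ (b₁ : complexBetti X₁ 2 →ₗ[ℂ] complexBetti X₁ 2 →ₗ[ℂ] ℂ)
      (b₂ : complexBetti X₂ 2 →ₗ[ℂ] complexBetti X₂ 2 →ₗ[ℂ] ℂ),
      IsFujikiForm n₁ X₁ b₁ ∧ IsFujikiForm n₂ X₂ b₂ ∧ ∀ x y, b₂ (f x) (f y) = b₁ x y :=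
  h.2.2.2

end IsRationalHodgeSimilitude

/-! ### The named facts -/

/-- **Varesco 2023 (Thm. 5.1 with Cor. 4.6) = Floccari–Varesco 2024, Theorem 3.3 — a rational Hodge
similitude `H²(X₁, ℚ) ⥲ H²(X₂, ℚ)` between projective varieties of generalized Kummer type, NOT
NECESSARILY OF THE SAME DIMENSION, is induced by an algebraic cycle on `X₁ × X₂`.**  Verbatim [FV24]:
"Let `X₁, X₂` be varieties of generalized Kummer type (not necessarily of the same dimension). Assume
that `φ : H²(X₁,ℚ) ⥲ H²(X₂,ℚ)` is a rational Hodge similitude. Then `φ` is induced by an algebraic cycle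
on `X₁ × X₂`."  Rendering (module docstring): for `2 ≤ n₁`, `2 ≤ n₂`, `Xᵢ` smooth projective of dimension
`2nᵢ` of `Kum^{nᵢ}`-type, and `f` a rational Hodge similitude (`IsRationalHodgeSimilitude`, multiplier
unrecorded), `f` is an algebraic correspondence from `X₁` to `X₂` (`IsAlgebraicCorrespondence
(2 * n₂) (2 * n₁) X₂ X₁ f`).  Printed proof: Kuga–Satake functoriality under similitudes ([Var23]
Prop. 3.1 / Thm. 4.5), the algebraicity of the Kuga–Satake correspondence for `Kumⁿ` (Voisin 2022, from
O'Grady 2021 and Markman 2023) and Foster's theorem (Grothendieck's `B` in degree `2` for `Kumⁿ`).  A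
THEOREM in print (REFEREED:
Math. Z. 2023, Math. Ann. 2024; unproved in the tree). [cite: FloccariVaresco2024, Thm. 3.3 (§3)]
[cite: Varesco2023, Thm. 5.1, Rem. 5.2 and Cor. 4.6 (§§4–5)] -/
def Varesco2023_hodgeSimilitude_algebraic_kummerType : Prop :=
  ∀ (n₁ n₂ : ℕ), 2 ≤ n₁ → 2 ≤ n₂ →
    ∀ ⦃X₁ X₂ : Motives.SchemeOver ℂ⦄, Motives.IsSmoothProjective (2 * n₁) X₁ →
      Motives.IsSmoothProjective (2 * n₂) X₂ →
      IsOfGeneralizedKummerType n₁ X₁ → IsOfGeneralizedKummerType n₂ X₂ →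
        ∀ (f : complexBetti X₁ 2 →ₗ[ℂ] complexBetti X₂ 2), IsRationalHodgeSimilitude n₁ n₂ X₁ X₂ f →
          IsAlgebraicCorrespondence (2 * n₂) (2 * n₁) X₂ X₁ f

/-- **Floccari–Varesco 2024, Lemma 4.3 — every projective `Kumⁿ`-variety is Hodge-similar in degree
`2` to a projective `Kum³`-variety.**  Verbatim: "For any projective variety `X` of `Kumⁿ`-type, there
exists a projective variety `K` of `Kum³`-type and a Hodge similitude of multiplier `n+1`
`φ : H²(K,ℚ) ⥲ H²(X,ℚ)` with respect to the Beauville-Bogomolov pairings."  Rendering: for `2 ≤ n` and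
`X` smooth projective of dimension `2n` of `Kumⁿ`-type there are a smooth projective `K` of dimension `6`
of `Kum³`-type and a rational Hodge similitude `f : H²(K(ℂ); ℂ) → H²(X(ℂ); ℂ)`
(`IsRationalHodgeSimilitude 3 n K X f`; the multiplier `n + 1` is NOT recorded — weaker than print in
this respect only).  Printed proof: the explicit similitude `e³ᵢ ↦ eⁿᵢ, f³ᵢ ↦ (n+1)fⁿᵢ, ξ³ ↦ ¼ξⁿ` of
`Λ_{Kum³} ⊗ ℚ ⥲ Λ_{Kumⁿ} ⊗ ℚ`, surjectivity of the period map for `Kum³`-type and Huybrechts'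
projectivity criterion.  A THEOREM in print (REFEREED: Math. Ann. 2024; unproved in the tree —
Torelli/surjectivity of periods for `Kumⁿ`-type is not in the tree).
[cite: FloccariVaresco2024, Lemma 4.3 (§4) and its proof] -/
def FloccariVaresco2024_exists_kum3_hodgeSimilitude : Prop :=
  ∀ (n : ℕ), 2 ≤ n → ∀ ⦃X : Motives.SchemeOver ℂ⦄, Motives.IsSmoothProjective (2 * n) X →
    IsOfGeneralizedKummerType n X →
      ∃ (K : Motives.SchemeOver ℂ) (f : complexBetti K 2 →ₗ[ℂ] complexBetti X 2),
        Motives.IsSmoothProjective 6 K ∧ IsOfGeneralizedKummerType 3 K ∧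
          IsRationalHodgeSimilitude 3 n K X f

/-- **Floccari–Varesco 2024, Remark 4.4 — on every power `Xʳ` of a projective `Kumⁿ`-variety, the
Hodge classes in the subalgebra generated by `H²(Xʳ, ℚ)` are algebraic.**  Verbatim: "Let `X` be a
`Kumⁿ`-variety as above and consider any power `Z = Xʳ`. Denote by `A₂•(Z)` the subalgebra of
`H•(Z,ℚ)` generated by `H²(Z,ℚ)`. Then our argument implies that all Hodge classes in `A₂•(Z)` are
algebraic."  Rendering: for `2 ≤ n`, `X` smooth projective of dimension `2n` of `Kumⁿ`-type, every `r`
and `j`, a class `c ∈ H^{2j}(Xʳ(ℂ); ℂ)` (`Xʳ = X.pow r`, dimension `r * (2 * n)`) which is rational, of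
Hodge type `(j,j)` and lies in `degreeTwoGenerated (X.pow r) j = A₂^{2j}(Xʳ) ⊗ ℂ` lies in
`algebraicClasses (X.pow r) j` — the rendering of Thm. 1.1
(`FloccariVaresco2024_degreeTwoGenerated_hodgeClasses_algebraic`) written on `Xʳ`.  A THEOREM in
print (REFEREED: Math. Ann. 2024, stated as a Remark with proof "our argument implies"; unproved in the
tree). [cite: FloccariVaresco2024, Remark 4.4 (§4)] -/
def FloccariVaresco2024_degreeTwoGenerated_hodgeClasses_algebraic_powers : Prop :=
  ∀ (n : ℕ), 2 ≤ n → ∀ ⦃X : Motives.SchemeOver ℂ⦄, Motives.IsSmoothProjective (2 * n) X →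
    IsOfGeneralizedKummerType n X →
      ∀ (r j : ℕ) (c : complexBetti (X.pow r) (2 * j)), IsRationalClass c →
        IsOfHodgeType (r * (2 * n)) (X.pow r) (2 * j) j j c → c ∈ degreeTwoGenerated (X.pow r) j →
          c ∈ algebraicClasses (X.pow r) j

/-! ### Kernel consequences -/

namespace Varesco2023_hodgeSimilitude_algebraic_kummerType

/-- **Floccari 2024 (Compositio), Theorem 1.4, by name** — the case `n₁ = n₂ = 3` (a Hodge isometry is a
Hodge similitude of multiplier `1`): a rational Hodge similitude between projective `Kum³`-varieties is
an algebraic correspondence.  Verbatim [Flo24]: "Let `K, K'` be projective varieties of deformation type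
`Kum³`. Let `f : H²(K, ℚ) ⥲ H²(K', ℚ)` be a Hodge isometry. Then `f` is induced by an algebraic
correspondence." [cite: Floccari2024, Thm. 1.4 (§1) and its proof in §5] [cite: FloccariVaresco2024, Thm. 3.3 (§3)] -/
theorem floccari2024_kum3Type (h : Varesco2023_hodgeSimilitude_algebraic_kummerType)
    {K K' : Motives.SchemeOver ℂ} (hK : Motives.IsSmoothProjective 6 K)
    (hK' : Motives.IsSmoothProjective 6 K') (hKum : IsOfGeneralizedKummerType 3 K)
    (hKum' : IsOfGeneralizedKummerType 3 K') {f : complexBetti K 2 →ₗ[ℂ] complexBetti K' 2}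
    (hf : IsRationalHodgeSimilitude 3 3 K K' f) : IsAlgebraicCorrespondence 6 6 K' K f :=
  h 3 3 (by norm_num) (by norm_num) hK hK' hKum hKum' f hf

/-- The same-dimension case `n₁ = n₂ = n` (Markman's expectation for `Kumⁿ`-type recorded in [Flo24] §1:
"He expects that an extension of his argument will lead to the analogous result for varieties of
`Kumⁿ`-type" — a theorem by [Var23]). [cite: Varesco2023, Thm. 5.1 and Rem. 5.2 (§5)]
[cite: Floccari2024, §1 (paragraph before Thm. 1.4)] -/
theorem sameType (h : Varesco2023_hodgeSimilitude_algebraic_kummerType) {n : ℕ} (hn : 2 ≤ n)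
    {X Y : Motives.SchemeOver ℂ} (hX : Motives.IsSmoothProjective (2 * n) X)
    (hY : Motives.IsSmoothProjective (2 * n) Y) (hKX : IsOfGeneralizedKummerType n X)
    (hKY : IsOfGeneralizedKummerType n Y) {f : complexBetti X 2 →ₗ[ℂ] complexBetti Y 2}
    (hf : IsRationalHodgeSimilitude n n X Y f) : IsAlgebraicCorrespondence (2 * n) (2 * n) Y X f :=
  h n n hn hn hX hY hKX hKY f hf

end Varesco2023_hodgeSimilitude_algebraic_kummerType

namespace FloccariVaresco2024_exists_kum3_hodgeSimilitude

/-- **First step of the proof of [FV24] Thm. 1.1 (kernel, modulo the two records): every projective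
`Kumⁿ`-variety `X` (`n ≥ 2`) receives, from some projective `Kum³`-variety `K`, an ALGEBRAIC
correspondence inducing a rational Hodge similitude `H²(K) ⥲ H²(X)`.**  Verbatim: "we consider the
`Kum³`-variety `K` given by Lemma 4.3. The same lemma gives a Hodge similitude
`φ : H²(K,ℚ) ⥲ H²(X,ℚ)`, which is induced by an algebraic cycle on `K × X` by Theorem 3.3."
[cite: FloccariVaresco2024, proof of Thm. 1.1 (§4, first paragraph) with Lemma 4.3 and Thm. 3.3] -/
theorem exists_algebraicCorrespondence (h : FloccariVaresco2024_exists_kum3_hodgeSimilitude)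
    (hV : Varesco2023_hodgeSimilitude_algebraic_kummerType) {n : ℕ} (hn : 2 ≤ n)
    {X : Motives.SchemeOver ℂ} (hX : Motives.IsSmoothProjective (2 * n) X)
    (hK : IsOfGeneralizedKummerType n X) :
    ∃ (K : Motives.SchemeOver ℂ) (f : complexBetti K 2 →ₗ[ℂ] complexBetti X 2),
      Motives.IsSmoothProjective 6 K ∧ IsOfGeneralizedKummerType 3 K ∧
        IsRationalHodgeSimilitude 3 n K X f ∧ IsAlgebraicCorrespondence (2 * n) 6 X K f := by
  obtain ⟨K, f, hKs, hKum, hf⟩ := h n hn hX hK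
  exact ⟨K, f, hKs, hKum, hf, hV 3 n (by norm_num) hn hKs hX hKum hK f hf⟩

/-- The `Kum⁴` spelling (dimension `8`) for the cell `hodge-kum4` (ladder HodgeAV, rung H3).
[cite: FloccariVaresco2024, Lemma 4.3 (§4)] -/
theorem kum4Type (h : FloccariVaresco2024_exists_kum3_hodgeSimilitude) {X : Motives.SchemeOver ℂ}
    (hX : Motives.IsSmoothProjective 8 X) (hK : IsOfGeneralizedKummerType 4 X) :
    ∃ (K : Motives.SchemeOver ℂ) (f : complexBetti K 2 →ₗ[ℂ] complexBetti X 2),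
      Motives.IsSmoothProjective 6 K ∧ IsOfGeneralizedKummerType 3 K ∧
        IsRationalHodgeSimilitude 3 4 K X f :=
  h 4 (by norm_num) hX hK

end FloccariVaresco2024_exists_kum3_hodgeSimilitude

namespace FloccariVaresco2024_degreeTwoGenerated_hodgeClasses_algebraic_powers

/-- The `Kum⁴` spelling (dimension `r * 8`) for the cell `hodge-kum4`: on every power `Xʳ` of a smooth
projective `Kum⁴`-type `X`, rational `(j,j)`-classes in `A₂^{2j}(Xʳ) ⊗ ℂ` are algebraic.
[cite: FloccariVaresco2024, Remark 4.4 (§4)] -/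
theorem kum4Type (h : FloccariVaresco2024_degreeTwoGenerated_hodgeClasses_algebraic_powers)
    {X : Motives.SchemeOver ℂ} (hX : Motives.IsSmoothProjective 8 X) (hK : IsOfGeneralizedKummerType 4 X)
    (r j : ℕ) (c : complexBetti (X.pow r) (2 * j)) (hc : IsRationalClass c)
    (hjj : IsOfHodgeType (r * 8) (X.pow r) (2 * j) j j c) (hA : c ∈ degreeTwoGenerated (X.pow r) j) :
    c ∈ algebraicClasses (X.pow r) j :=
  h 4 (by norm_num) hX hK r j c hc hjj hA

/-- The powers `Xʳ` in their own dimension bookkeeping: `Xʳ` is smooth projective of dimension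
`r * (2n)` (kernel: `Motives.IsSmoothProjective.pow`), so the record's Hodge-type clause is the one of
the tree's per-variety Hodge statement for `Xʳ`. [cite: FloccariVaresco2024, Remark 4.4 (§4)] -/
theorem isSmoothProjective_pow {n : ℕ} {X : Motives.SchemeOver ℂ}
    (hX : Motives.IsSmoothProjective (2 * n) X) (r : ℕ) :
    Motives.IsSmoothProjective (r * (2 * n)) (X.pow r) :=
  hX.pow r

end FloccariVaresco2024_degreeTwoGenerated_hodgeClasses_algebraic_powers

end Literature.AlgebraicGeometry.Hyperkaehler

end
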